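import Mathlib.Analysis.Calculus.BumpFunction.Normed
import Literature.Analysis.FunctionSpaces.DuBoisReymondAE
import HarnessLib

/-!
# Functions orthogonal to all derivatives of test functions are a.e. constant

Analysis/FunctionSpaces support file (serves the discharge of Onsager rigidity,
`Literature.Analysis.FluidPDE.onsager_rigidity`, `FluidPDE/Onsager`: the energy `t ↦ E(u(t))` of a weak Euler
solution is shown to satisfy `∫ η' E = 0` for all test functions `η` on `(0, T)`, i.e. `E' = 0` in
`𝒟'(0, T)`, and one concludes that `E` is a.e. equal to a constant; Constantin–E–Titi 1994, the
step "(2) holds" read for `L²_{t,x}` weak solutions).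

* `Literature.Analysis.FunctionSpaces.exists_contDiff_tsupport_subset_Ioo_integral_eq_one`: on every nonempty open interval
  there is a smooth compactly supported `ψ` with `∫ ψ = 1`;
* `Literature.Analysis.FunctionSpaces.exists_Icc_subset_Ioo_of_tsupport_subset`: a compactly supported function with
  `tsupport ⊆ (a, b)` vanishes off a compact subinterval `[a', b'] ⊂ (a, b)`;
* `Literature.Analysis.FunctionSpaces.ae_eq_const_of_forall_setIntegral_deriv_mul_eq_zero` — **the lemma**: if `E` is integrable
  on `(a, b)` and `∫_{(a,b)} η' E = 0` for every smooth compactly supported `η` with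
  `tsupport η ⊆ (a, b)`, then `E = c` a.e. on `(a, b)` for some constant `c`
  (Brezis 2011, Lemma 8.1 and Cor. 8.10 ("`u' = 0` implies `u` constant"); Hörmander, *ALPDO I*,
  Thm. 3.1.4 for distributions).

Proof of the lemma (Brezis, proof of Lemma 8.1): fix `ψ` as above and put `c = ∫_{(a,b)} ψ E`.
For a test function `φ` on `(a, b)` the function `g = φ - (∫ φ) ψ` is a test function with
`∫ g = 0`, hence `g = η'` for the test function `η(t) = ∫ₐᵗ g`; so `∫ g E = 0`, i.e.
`∫ φ (E - c) = 0`, and the fundamental lemma of the calculus of variations (Mathlib's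
`IsOpen.ae_eq_zero_of_integral_contDiff_smul_eq_zero`) gives `E = c` a.e.

## Mathlib search

Mathlib (this pin) has the fundamental lemma of the calculus of variations
(`IsOpen.ae_eq_zero_of_integral_contDiff_smul_eq_zero`) but not the "vanishing distributional
derivative implies constant" statement (searched `ae_eq_const`, `deriv` + `tsupport` in
`Mathlib/Analysis/Distribution`, `Mathlib/MeasureTheory/Function`). The tree's
`Literature.Analysis.FunctionSpaces.ae_eq_add_setIntegral_of_forall_test` (`DuBoisReymondAE`) is the variant with an initial
datum, whose test functions do not vanish at the left endpoint; it does not apply to test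
functions supported inside the open interval, which is all a weak formulation on `(0, T)` provides.

## References

* H. Brezis, *Functional Analysis, Sobolev Spaces and PDE* (Springer 2011), Lemma 8.1, Cor. 8.10.
* L. Hörmander, *The Analysis of Linear Partial Differential Operators I*, 2nd ed. (1990),
  Thm. 3.1.4.
* P. Constantin, W. E, E. S. Titi, *Onsager's conjecture on the energy conservation for solutions
  of Euler's equation*, Comm. Math. Phys. 165 (1994), 207–209.
-/

noncomputable section

open MeasureTheory TopologicalSpace Set Function Filter Topology intervalIntegral
open scoped ContDiff

namespace Literature.Analysis.FunctionSpaces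

/-- On a nonempty open interval `(a, b)` there is a smooth compactly supported `ψ ≥ 0` with
`tsupport ψ ⊆ (a, b)` and `∫ ψ = 1` (a normalised bump centred at the midpoint). [folklore] -/
theorem exists_contDiff_tsupport_subset_Ioo_integral_eq_one {a b : ℝ} (hab : a < b) :
    ∃ ψ : ℝ → ℝ, ContDiff ℝ ∞ ψ ∧ HasCompactSupport ψ ∧ tsupport ψ ⊆ Ioo a b ∧
      ∫ t, ψ t = 1 := by
  let B : ContDiffBump ((a + b) / 2 : ℝ) := ⟨(b - a) / 8, (b - a) / 4, by linarith, by linarith⟩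
  have hBr : B.rOut = (b - a) / 4 := rfl
  refine ⟨B.normed volume, B.contDiff_normed, B.hasCompactSupport_normed, ?_, B.integral_normed⟩
  rw [B.tsupport_normed_eq, hBr]
  intro t ht
  rw [Metric.mem_closedBall, Real.dist_eq, abs_le] at ht
  constructor <;> linarith [ht.1, ht.2]

/-- A compactly supported function with `tsupport ⊆ (a, b)`, `a < b`, vanishes off some compact
subinterval `[a', b']` with `a < a' ≤ b' < b`. [folklore] -/
theorem exists_Icc_subset_Ioo_of_tsupport_subset {E : Type*} [Zero E] {η : ℝ → E} {a b : ℝ}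
    (hab : a < b) (hη : HasCompactSupport η) (h : tsupport η ⊆ Ioo a b) :
    ∃ a' b', a < a' ∧ a' ≤ b' ∧ b' < b ∧ ∀ t, η t ≠ 0 → t ∈ Icc a' b' := by
  by_cases hne : (tsupport η).Nonempty
  · have hsup : sSup (tsupport η) ∈ tsupport η := hη.isCompact.sSup_mem hne
    have hinf : sInf (tsupport η) ∈ tsupport η := hη.isCompact.sInf_mem hne
    refine ⟨sInf (tsupport η), sSup (tsupport η), (h hinf).1,
      csInf_le hη.isCompact.bddBelow hsup, (h hsup).2, fun t ht => ?_⟩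
    have ht' : t ∈ tsupport η := subset_tsupport _ (mem_support.2 ht)
    exact ⟨csInf_le hη.isCompact.bddBelow ht', le_csSup hη.isCompact.bddAbove ht'⟩
  · refine ⟨(a + b) / 2, (a + b) / 2, by linarith, le_rfl, by linarith, fun t ht => ?_⟩
    exact absurd ⟨t, subset_tsupport _ (mem_support.2 ht)⟩ hne

/-- The primitive `t ↦ ∫ₐᵗ g` of a function `g` vanishing off `(a', b')`, `a ≤ a'`, with
`∫ g = 0`, vanishes for `t ≤ a'` and for `b' ≤ t`. [folklore] -/
theorem primitive_eq_zero_of_integral_eq_zero {g : ℝ → ℝ} {a a' b' : ℝ} (haa' : a ≤ a')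
    (hsupp : ∀ t, g t ≠ 0 → t ∈ Ioo a' b') (hint : ∫ t, g t = 0) (t : ℝ)
    (ht : t ≤ a' ∨ b' ≤ t) : ∫ s in a..t, g s = 0 := by
  have hz : ∀ s, s ∉ Ioo a' b' → g s = 0 := fun s hs => by
    by_contra h
    exact hs (hsupp s h)
  rcases ht with ht | ht
  · -- on `uIoc a t ⊆ (-∞, a']` the integrand vanishes
    refine intervalIntegral.integral_zero_ae (Eventually.of_forall fun s hs => hz s fun hs' => ?_)
    rcases le_total a t with hat | hta
    · rw [uIoc_of_le hat] at hs
      linarith [hs.2, hs'.1]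
    · rw [uIoc_of_ge hta] at hs
      linarith [hs.2, hs'.1]
  · -- `∫ₐᵗ g = ∫ g = 0` since `g` vanishes off `(a, t]`
    have hsub : support g ⊆ Ioc a t := fun s hs => by
      have h' := hsupp s hs
      exact ⟨lt_of_le_of_lt haa' h'.1, h'.2.le.trans ht⟩
    rw [intervalIntegral.integral_eq_integral_of_support_subset hsub, hint]

/-- **Vanishing distributional derivative on an interval implies a.e. constancy.** If `E` is
integrable on `(a, b)` and `∫_{(a,b)} η' E = 0` for every smooth compactly supported `η : ℝ → ℝ`
with `tsupport η ⊆ (a, b)`, then there is a constant `c` with `E = c` a.e. on `(a, b)`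
(Brezis 2011, Lemma 8.1 with Cor. 8.10; Hörmander, Thm. 3.1.4). Proof as in Brezis: with a fixed
test function `ψ` of unit integral, `c = ∫_{(a,b)} ψ E`, every test function `φ` decomposes as
`φ = (∫ φ) ψ + η'` with `η(t) = ∫ₐᵗ (φ - (∫ φ) ψ)` again a test function on `(a, b)`, so
`∫ φ (E - c) = 0`, and Mathlib's fundamental lemma of the calculus of variations concludes.
[cite: Brezis2011, Lemma 8.1] -/
theorem ae_eq_const_of_forall_setIntegral_deriv_mul_eq_zero {a b : ℝ} {E : ℝ → ℝ}
    (hE : IntegrableOn E (Ioo a b))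
    (h : ∀ η : ℝ → ℝ, ContDiff ℝ ∞ η → HasCompactSupport η → tsupport η ⊆ Ioo a b →
      ∫ t in Ioo a b, deriv η t * E t = 0) :
    ∃ c, ∀ᵐ t ∂(volume.restrict (Ioo a b)), E t = c := by
  rcases le_or_gt b a with hba | hab
  · refine ⟨0, ?_⟩
    rw [Ioo_eq_empty_of_le hba, Measure.restrict_empty, ae_zero]
    exact eventually_bot
  obtain ⟨ψ, hψs, hψc, hψsupp, hψ1⟩ := exists_contDiff_tsupport_subset_Ioo_integral_eq_one hab
  obtain ⟨a₁, b₁, ha₁, -, hb₁, hψz⟩ := exists_Icc_subset_Ioo_of_tsupport_subset hab hψc hψsupp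
  set c : ℝ := ∫ t in Ioo a b, ψ t * E t with hc
  refine ⟨c, ?_⟩
  -- Step 1: every test function `φ` on `(a, b)` satisfies `∫_{(a,b)} φ E = (∫ φ) c`.
  have hφE : ∀ φ : ℝ → ℝ, ContDiff ℝ ∞ φ → HasCompactSupport φ → tsupport φ ⊆ Ioo a b →
      ∫ t in Ioo a b, φ t * E t = (∫ t, φ t) * c := by
    intro φ hφs hφc hφsupp
    obtain ⟨a₂, b₂, ha₂, -, hb₂, hφz⟩ := exists_Icc_subset_Ioo_of_tsupport_subset hab hφc hφsupp
    set m : ℝ := ∫ t, φ t with hm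
    set g : ℝ → ℝ := fun t => φ t - m * ψ t with hg
    have hgs : ContDiff ℝ ∞ g := hφs.sub (contDiff_const.mul hψs)
    have hgcont : Continuous g := hgs.continuous
    -- `g` vanishes off `(a', b')` with `a < a'`, `b' < b`
    set a' : ℝ := (a + min a₁ a₂) / 2 with ha'
    set b' : ℝ := (b + max b₁ b₂) / 2 with hb'
    have haa' : a < a' := by
      rw [ha']; have := lt_min ha₁ ha₂; linarith
    have hb'b : b' < b := by
      rw [hb']; have := max_lt hb₁ hb₂; linarith
    have hgz : ∀ t, g t ≠ 0 → t ∈ Ioo a' b' := fun t ht => by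
      have h' : φ t ≠ 0 ∨ ψ t ≠ 0 := by
        by_contra hcon
        simp only [not_or, not_not] at hcon
        exact ht (by simp only [hg, hcon.1, hcon.2, mul_zero, sub_zero])
      have hmin : min a₁ a₂ ≤ t ∧ t ≤ max b₁ b₂ := by
        rcases h' with h' | h'
        · exact ⟨(min_le_right _ _).trans (hφz t h').1, (hφz t h').2.trans (le_max_right _ _)⟩
        · exact ⟨(min_le_left _ _).trans (hψz t h').1, (hψz t h').2.trans (le_max_left _ _)⟩
      have h1 := lt_min ha₁ ha₂
      have h2 := max_lt hb₁ hb₂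
      constructor
      · rw [ha']; linarith [hmin.1]
      · rw [hb']; linarith [hmin.2]
    -- `∫ g = 0`
    have hφi : Integrable φ volume := hφs.continuous.integrable_of_hasCompactSupport hφc
    have hψi : Integrable ψ volume := hψs.continuous.integrable_of_hasCompactSupport hψc
    have hg0 : ∫ t, g t = 0 := by
      simp only [hg]
      rw [integral_sub hφi (hψi.const_mul m), MeasureTheory.integral_const_mul, hψ1, mul_one, sub_self]
    -- the primitive `η(t) = ∫ₐᵗ g` is a test function on `(a, b)` with `η' = g`
    set η : ℝ → ℝ := fun t => ∫ s in a..t, g s with hη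
    have hηs : ContDiff ℝ ∞ η := contDiff_primitive hgs a
    have hηd : ∀ t, HasDerivAt η (g t) t := fun t =>
      (hgcont.integral_hasStrictDerivAt a t).hasDerivAt
    have hηz : ∀ t, t ∉ Ioo a' b' → η t = 0 := fun t ht => by
      refine primitive_eq_zero_of_integral_eq_zero haa'.le hgz hg0 t ?_
      simp only [mem_Ioo, not_and_or, not_lt] at ht
      exact ht
    have hηsub : tsupport η ⊆ Icc a' b' :=
      closure_minimal (fun t ht => by
        by_contra h'
        exact ht (hηz t fun h'' => h' (Ioo_subset_Icc_self h''))) isClosed_Icc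
    have hηc : HasCompactSupport η :=
      HasCompactSupport.of_support_subset_isCompact isCompact_Icc
        ((subset_tsupport η).trans hηsub)
    have hηsupp : tsupport η ⊆ Ioo a b :=
      hηsub.trans (Icc_subset_Ioo haa' hb'b)
    have key := h η hηs hηc hηsupp
    have hderiv : deriv η = g := funext fun t => (hηd t).deriv
    rw [hderiv] at key
    -- unfold `g` in `∫ g E = 0`
    have hφEi : IntegrableOn (fun t => φ t * E t) (Ioo a b) :=
      integrableOn_continuous_mul_of_hasCompactSupport hE hφs.continuous hφc
    have hψEi : IntegrableOn (fun t => ψ t * E t) (Ioo a b) :=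
      integrableOn_continuous_mul_of_hasCompactSupport hE hψs.continuous hψc
    have hsplit : ∫ t in Ioo a b, g t * E t =
        (∫ t in Ioo a b, φ t * E t) - m * ∫ t in Ioo a b, ψ t * E t := by
      rw [← MeasureTheory.integral_const_mul, ← integral_sub hφEi (hψEi.const_mul m)]
      refine integral_congr_ae (Eventually.of_forall fun t => ?_)
      simp only [hg]
      ring
    rw [hsplit, sub_eq_zero] at key
    rw [key]
  -- Step 2: the fundamental lemma of the calculus of variations for `E - c` on `(a, b)`.
  have hφ0 : ∀ φ : ℝ → ℝ, ContDiff ℝ ∞ φ → HasCompactSupport φ → tsupport φ ⊆ Ioo a b →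
      ∫ t, φ t • (E t - c) ∂(volume.restrict (Ioo a b)) = 0 := by
    intro φ hφs hφc hφsupp
    have hφEi : IntegrableOn (fun t => φ t * E t) (Ioo a b) :=
      integrableOn_continuous_mul_of_hasCompactSupport hE hφs.continuous hφc
    have hφi : Integrable φ volume := hφs.continuous.integrable_of_hasCompactSupport hφc
    have hφab : ∫ t in Ioo a b, φ t = ∫ t, φ t :=
      setIntegral_eq_integral_of_forall_compl_eq_zero fun t ht =>
        image_eq_zero_of_notMem_tsupport fun h' => ht (hφsupp h')
    simp only [smul_eq_mul, mul_sub]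
    rw [integral_sub hφEi (hφi.integrableOn.mul_const c), MeasureTheory.integral_mul_const, hφab,
      hφE φ hφs hφc hφsupp, sub_self]
  have hloc : LocallyIntegrableOn (fun t => E t - c) (Ioo a b) (volume.restrict (Ioo a b)) := by
    have hi : IntegrableOn (fun t => E t - c) (Ioo a b) :=
      hE.sub (integrableOn_const (by rw [Real.volume_Ioo]; exact ENNReal.ofReal_ne_top))
    exact hi.locallyIntegrable.locallyIntegrableOn _
  have hae := (isOpen_Ioo (a := a) (b := b)).ae_eq_zero_of_integral_contDiff_smul_eq_zero hloc hφ0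
  filter_upwards [hae, ae_restrict_mem measurableSet_Ioo] with t ht hmem
  linarith [ht hmem]

end Literature.Analysis.FunctionSpaces
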